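import Summits.Ventures.HSemireg.WedgeHankelRecurrencePeriodFinite

/-!
# Venture HSemireg — LEAST PERIOD AND LINEAR COMPLEXITY OVER ANY FIELD: if a reduced rational class `dualSeq m a` (`m` monic, `gcd(m, a) = 1`) has SOME positive period `T`, then
# **`ord(m) = polOrd m` is positive, is its least period, divides `T`, and `deg m ≤ ord(m) ≤ T`** («a periodic LFSR class has least period `ord(m)`, and its linear complexity `deg m` is at most
# any period») — N85's finite-field statement with finiteness replaced by the existence of one period

HONEST FRAMING. Part of the Lean index of the computation cell `pub-hsemireg` (seat p10 gen 30, Sunday typer «UNIFORM-IN-n»).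
LINEAR ALGEBRA OF HANKEL (catalecticant) MATRICES and of polynomials over a field ONLY: no variety, no cohomology theory, no sheaf, no Ext group and no semiregularity map is constructed
here; nothing here says that HC / HC_CM / HC_AV holds.  No unproved named fact is used (PROVED Literature `OrderOfPolynomial`: `polOrd`, `dvd_X_pow_sub_one_iff`, `dvd_X_pow_polOrd_sub_one`, through N85;
nothing restated).  Custodian versions as in `WedgeHankelSiegelIdeal` (1/3).

WHAT IS IN THE TREE.  N81: `periodic_dualSeq_iff_dvd`.  N85: `periodic_dualSeq_iff_polOrd_dvd`, `periodic_dualSeq_polOrd`.  Mathlib: `Polynomial.natDegree_le_of_dvd`, `Polynomial.natDegree_X_pow_sub_C`,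
`Polynomial.X_pow_sub_C_ne_zero`, `Nat.pos_of_dvd_of_pos`, `Nat.le_of_dvd`.
THIS FILE (namespace `Summit.Ventures.HSemireg.Wedge.HankelOuter` continued; CHAINED on N85; 0 definitions; every statement over an ARBITRARY field):
* §645 **`natDegree_le_of_periodic_dualSeq`** (LINEAR COMPLEXITY ≤ PERIOD: a positive period `T` of a reduced class mod `m` has `deg m ≤ T`), `polOrd_pos_of_periodic_dualSeq` and
  `polOrd_le_of_periodic_dualSeq` (then `0 < ord(m) ≤ T`), `natDegree_le_polOrd_of_periodic_dualSeq` (`deg m ≤ ord(m)`), **`isLeast_setOf_periodic_dualSeq_of_periodic`** (THE LEAST PERIOD IS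
  `ord(m)` as soon as one positive period exists).
Nothing Ext-side.  New names only.
-/

open Module Polynomial
open scoped Matrix Polynomial

namespace Summit.Ventures.HSemireg.Wedge.HankelOuter

open Summit.Ventures.HSemireg.Wedge Summit.Ventures.HSemireg.Wedge.Hankel
open Literature.Algebra.Polynomial.OrderOfPolynomial

variable (K : Type*) [Field K]

/-! ## §645. Least period and linear complexity over any field -/

/-- **LINEAR COMPLEXITY ≤ PERIOD**: if the reduced class `dualSeq m a` (`m` monic, `gcd(m, a) = 1`) is `T`-periodic with `T > 0`, then `deg m ≤ T` (`m ∣ X^T − 1`). Any field. -/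
theorem natDegree_le_of_periodic_dualSeq {m a : K[X]} (hm : m.Monic) (hcop : IsCoprime m a) {T : ℕ} (hT : 0 < T) (hper : Function.Periodic (dualSeq K m a) T) :
    m.natDegree ≤ T := by
  have h := (periodic_dualSeq_iff_dvd K hm hcop T).mp hper
  rw [← map_one Polynomial.C] at h
  calc m.natDegree ≤ (Polynomial.X ^ T - Polynomial.C (1 : K)).natDegree := Polynomial.natDegree_le_of_dvd h (Polynomial.X_pow_sub_C_ne_zero hT 1)
    _ = T := Polynomial.natDegree_X_pow_sub_C

/-- a positive period of a reduced class mod `m` forces `ord(m) > 0` (`ord(m) ∣ T`). Any field. -/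
theorem polOrd_pos_of_periodic_dualSeq {m a : K[X]} (hm : m.Monic) (hcop : IsCoprime m a) {T : ℕ} (hT : 0 < T) (hper : Function.Periodic (dualSeq K m a) T) :
    0 < polOrd m :=
  Nat.pos_of_dvd_of_pos ((periodic_dualSeq_iff_polOrd_dvd K hm hcop T).mp hper) hT

/-- … and `ord(m) ≤ T`. Any field. -/
theorem polOrd_le_of_periodic_dualSeq {m a : K[X]} (hm : m.Monic) (hcop : IsCoprime m a) {T : ℕ} (hT : 0 < T) (hper : Function.Periodic (dualSeq K m a) T) :
    polOrd m ≤ T :=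
  Nat.le_of_dvd hT ((periodic_dualSeq_iff_polOrd_dvd K hm hcop T).mp hper)

/-- **`deg m ≤ ord(m)`** for a reduced class with a positive period (linear complexity ≤ least period). Any field. -/
theorem natDegree_le_polOrd_of_periodic_dualSeq {m a : K[X]} (hm : m.Monic) (hcop : IsCoprime m a) {T : ℕ} (hT : 0 < T) (hper : Function.Periodic (dualSeq K m a) T) :
    m.natDegree ≤ polOrd m :=
  natDegree_le_of_periodic_dualSeq K hm hcop (polOrd_pos_of_periodic_dualSeq K hm hcop hT hper) (periodic_dualSeq_polOrd K hm a)

/-- **THE LEAST PERIOD IS `ord(m)` OVER ANY FIELD**: if the reduced class `dualSeq m a` has some positive period, its least positive period is `polOrd m` (N85's finite-field statement needs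
only the existence of one period). -/
theorem isLeast_setOf_periodic_dualSeq_of_periodic {m a : K[X]} (hm : m.Monic) (hcop : IsCoprime m a) {T : ℕ} (hT : 0 < T) (hper : Function.Periodic (dualSeq K m a) T) :
    IsLeast {T : ℕ | 0 < T ∧ Function.Periodic (dualSeq K m a) T} (polOrd m) :=
  ⟨⟨polOrd_pos_of_periodic_dualSeq K hm hcop hT hper, periodic_dualSeq_polOrd K hm a⟩, fun _ hT' => polOrd_le_of_periodic_dualSeq K hm hcop hT'.1 hT'.2⟩

end Summit.Ventures.HSemireg.Wedge.HankelOuter
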